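import Literature.NumberTheory.Automorphic.AdicCompletionLocalField
import Literature.NumberTheory.Automorphic.ValuedFieldValuativeRelBridge
import Literature.NumberTheory.GaloisRepresentations.LocalExistenceTheorem
import Literature.NumberTheory.GaloisRepresentations.HeckeCharacter
import Literature.GroupTheory.PiCharacterFactorsFinitely
import Mathlib.RingTheory.RootsOfUnity.AlgebraicallyClosed
import Mathlib.Analysis.Complex.Polynomial.Basic
import Mathlib.GroupTheory.FiniteAbelian.Duality
import HarnessLib

/-!
# Anti-invariant characters of a local field factor through `x ↦ x/σx` by a character of FINITE ORDER

Topic `NumberTheory/Automorphic`; namespace `Literature.NumberTheory.Automorphic.LocalAntiInvariantCharacter`.  THEOREMS ONLY (no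
definition, no instance, no notation, no named fact, no `sorry`).  Cell `hodgecm-mathlib` (D-0151), seat B-p14 (g28); the local half of the
globalisation «every `ω`-type character of `(L ⊗ L⁺_v)ˣ` is a local component of a conjugate-symplectic Hecke character»
(`ConjugateSymplecticLocalComponentSurjective.lean`).

THE STATEMENT (`exists_isOfFinOrder_apply_mul_inv_eq`).  `K` a number field, `w` a finite place, `σ` an INVOLUTIVE, VALUATION-PRESERVING
field automorphism of the completion `K_w`, `Λ : K_wˣ → ℂˣ` a CONTINUOUS character trivial on the `σ`-fixed units.  Then there is a character
`θ : K_wˣ → ℂˣ` with OPEN KERNEL and of FINITE ORDER such that `θ(x · (σx)⁻¹) = Λ(x)` for every `x ∈ K_wˣ` — exactly the local input shape of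
[ClozelHarrisTaylor2008, Lem. 4.1.1] (★ `ClozelHarrisTaylor2008.exists_heckeCharacter_isFiniteOrder_localComponent_eq`).

THE PROOF (all inputs ★ or Mathlib).  (1) `ℂˣ` has no small subgroups (★ `PiCharacter.isNSSNhd_units_complex`), so the continuous `Λ` kills a
congruence ball `1 + 𝔭ⁿ` (a subgroup by the ultrametric inequality).  (2) Explicit Hilbert 90 near `1`: if `y := x/σx ≡ 1 (mod 2𝔭ⁿ)` then
`b := (1 + y)/2 ≡ 1 (mod 𝔭ⁿ)` satisfies `b/σb = y`, so `x/b` is `σ`-fixed and `Λ(x) = Λ(b) = 1`.  (3) Hence `Λ` descends to the image of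
`x ↦ x/σx` in the FINITE group `𝒪_wˣ/(1 + 2𝔭ⁿ)` (`𝒪_wˣ` compact ★ `isCompact_unitGroup`, `1 + 2𝔭ⁿ` open: Mathlib `Subgroup.quotient_finite_of_isOpen`),
extends to the whole finite group by duality for finite abelian groups (Mathlib `MonoidHom.restrict_surjective`, `ℂ` has enough roots of
unity), and is pulled back along the unit-part retraction `x ↦ x ϖ^{ord x}` ([NeukirchANT1999, Ch. II §5 (5.3)]).  No Pontryagin duality, no
`ℚ/ℤ`.  HONEST LABEL: HC_CM is proved only modulo the printed citations until rung 0 closes; this file is generic local class-field bookkeeping.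

## Mathlib / tree search
Mathlib: `Units.isEmbedding_val₀`, `Valued.mem_nhds` (+ `Valuation.restrict_*`), `Subgroup.isOpen_of_mem_nhds`, `Subgroup.quotient_finite_of_isOpen`,
`QuotientGroup.quotientKerEquivRange`, `QuotientGroup.lift`, `MonoidHom.restrict_surjective`, `IsSepClosed.hasEnoughRootsOfUnity`, `pow_card_eq_one'`.
Tree (★): `PiCharacter.isNSSNhd_units_complex`, `GaloisRepresentations.isCompact_unitGroup` + `AdicCompletionLocalField` (the `IsNonarchimedeanLocalField`
instance) + `ValuedFieldValuativeRelBridge.v_eq_one_iff_valuation_eq_one`, `HeckeCharacter.uniformizer`/`valued_uniformizer`.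
`lean search 'IsOfFinOrder.*mapEquiv|exists_isOfFinOrder_apply_mul_inv'`: nothing; the only precedent is the private `exists_unitPart` of
`Liu2021/LemD1AsPrintedIndexedNonVacuityTameTwist` (re-proved here as `exists_unitRetraction`).

## References
* [SerreLocalFields1979] J.-P. Serre, *Local Fields*, GTM 67 (1979), Ch. X §1 Prop. 2–3 (Hilbert 90).
* [NeukirchANT1999] J. Neukirch, *Algebraic Number Theory* (1999), Ch. II §5 Prop. (5.3) (`K_wˣ = (ϖ) × 𝒪_wˣ`), Ch. V §1 Thm. (1.3).
* [ClozelHarrisTaylor2008] L. Clozel, M. Harris, R. Taylor, Publ. Math. IHÉS 108 (2008), Lemma 4.1.1 (p. 116).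
-/

set_option autoImplicit false

noncomputable section

open NumberField IsDedekindDomain
open scoped Topology

namespace Literature.NumberTheory.Automorphic.LocalAntiInvariantCharacter

section Local

variable {K : Type} [Field K] [NumberField K] (w : HeightOneSpectrum (𝓞 K))

/-- The congruence ball `{x : v(x − 1) < γ}` (`γ ≤ 1`) of `K_wˣ` is a subgroup (ultrametric inequality). [folklore] -/
private theorem exists_ballSubgroup
    (γ : (MonoidWithZeroHom.ValueGroup₀ (.ofClass (Valued.v : Valuation (w.adicCompletion K) (WithZero (Multiplicative ℤ)))))ˣ)
    (hγ : (γ : MonoidWithZeroHom.ValueGroup₀ (.ofClass (Valued.v : Valuation (w.adicCompletion K) (WithZero (Multiplicative ℤ))))) ≤ 1) :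
    ∃ H : Subgroup (w.adicCompletion K)ˣ, ∀ x : (w.adicCompletion K)ˣ,
      x ∈ H ↔ Valued.v.restrict ((x : w.adicCompletion K) - 1) < γ := by
  have hv1 : ∀ x : (w.adicCompletion K)ˣ, Valued.v.restrict ((x : w.adicCompletion K) - 1) < γ →
      Valued.v.restrict (x : w.adicCompletion K) = 1 := fun x hx => by
    have h := Valuation.map_one_add_of_lt Valued.v.restrict (lt_of_lt_of_le hx hγ)
    rwa [add_sub_cancel] at h
  refine ⟨{ carrier := {x | Valued.v.restrict ((x : w.adicCompletion K) - 1) < γ}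
            mul_mem' := ?_, one_mem' := ?_, inv_mem' := ?_ }, fun x => Iff.rfl⟩
  · intro x y hx hy
    simp only [Set.mem_setOf_eq, Units.val_mul] at hx hy ⊢
    have h : (x : w.adicCompletion K) * y - 1 = x * (y - 1) + (x - 1) := by ring
    rw [h]
    refine Valuation.map_add_lt _ ?_ hx
    rw [Valuation.map_mul, hv1 x hx, one_mul]
    exact hy
  · simp only [Set.mem_setOf_eq, Units.val_one, sub_self, Valuation.map_zero]
    exact zero_lt_iff.2 γ.ne_zero
  · intro x hx
    simp only [Set.mem_setOf_eq] at hx ⊢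
    have hx0 : (x : w.adicCompletion K) ≠ 0 := x.ne_zero
    have h : ((x⁻¹ : (w.adicCompletion K)ˣ) : w.adicCompletion K) - 1 = (x : w.adicCompletion K)⁻¹ * (1 - x) := by
      rw [Units.val_inv_eq_inv_val, mul_sub, mul_one, inv_mul_cancel₀ hx0]
    rw [h, Valuation.map_mul, map_inv₀, hv1 x hx, inv_one, one_mul, Valuation.map_sub_swap]
    exact hx

/-- The unit-part retraction `x ↦ x · ϖ^{ord x}` of `K_wˣ` onto `𝒪_wˣ = {v = 1}` (a homomorphism, the identity on `𝒪_wˣ`).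
[cite: NeukirchANT1999, Ch. II §5 Prop. (5.3)] -/
private theorem exists_unitRetraction :
    ∃ υ : (w.adicCompletion K)ˣ →* (w.adicCompletion K)ˣ,
      (∀ x, Valued.v ((υ x : (w.adicCompletion K)ˣ) : w.adicCompletion K) = 1) ∧
      ∀ x : (w.adicCompletion K)ˣ, Valued.v (x : w.adicCompletion K) = 1 → υ x = x := by
  set ϖ : (w.adicCompletion K)ˣ := GaloisRepresentations.HeckeCharacter.uniformizer K w with hϖdef
  have hϖ : Valued.v (ϖ : w.adicCompletion K) = WithZero.exp (-1 : ℤ) := GaloisRepresentations.HeckeCharacter.valued_uniformizer w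
  have hne : ∀ x : (w.adicCompletion K)ˣ, Valued.v (x : w.adicCompletion K) ≠ 0 := fun x =>
    (Valuation.ne_zero_iff _).2 x.ne_zero
  let f : (w.adicCompletion K)ˣ →* (w.adicCompletion K)ˣ :=
    { toFun := fun x => x * ϖ ^ WithZero.log (Valued.v (x : w.adicCompletion K))
      map_one' := by rw [Units.val_one, map_one, WithZero.log_one, zpow_zero, one_mul]
      map_mul' := fun x y => by
        rw [Units.val_mul, map_mul, WithZero.log_mul (hne x) (hne y), zpow_add, mul_mul_mul_comm] }
  refine ⟨f, fun x => ?_, fun x hx => ?_⟩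
  · change Valued.v (((x * ϖ ^ WithZero.log (Valued.v (x : w.adicCompletion K)) : (w.adicCompletion K)ˣ)) :
      w.adicCompletion K) = 1
    obtain ⟨m, hm⟩ : ∃ m : ℤ, Valued.v (x : w.adicCompletion K) = WithZero.exp m := ⟨_, (WithZero.exp_log (hne x)).symm⟩
    rw [Units.val_mul, Units.val_zpow_eq_zpow_val, map_mul, map_zpow₀, hϖ, ← WithZero.exp_zsmul, smul_eq_mul,
      mul_neg, mul_one, hm, WithZero.log_exp, ← WithZero.exp_add, add_neg_cancel, WithZero.exp_zero]
  · change x * ϖ ^ WithZero.log (Valued.v (x : w.adicCompletion K)) = x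
    rw [hx, WithZero.log_one, zpow_zero, mul_one]

/-- **Local extension step.**  Let `σ` be an involutive, valuation-preserving field automorphism of `K_w` and `Λ : K_wˣ → ℂˣ` a continuous
character killing the `σ`-fixed units.  Then `Λ = θ ∘ (x ↦ x · (σ x)⁻¹)` for a character `θ` of `K_wˣ` of FINITE ORDER with OPEN KERNEL: `Λ` kills a
congruence ball (no small subgroups in `ℂˣ`); a unit `x` with `y := x/σx` close to `1` is `b · (fixed)` with `b = (1 + y)/2` close to `1` (Hilbert 90,
explicit), so `Λ` kills every `x` with `x/σx ∈ 1 + 𝔭ⁿ`; hence `Λ` descends to the image of `x ↦ x/σx` in the FINITE group `𝒪_wˣ/(1 + 𝔭ⁿ)` (`𝒪_wˣ`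
compact, `1 + 𝔭ⁿ` open), extends to all of it (duality for finite abelian groups, Mathlib `MonoidHom.restrict_surjective`), and is pulled back along
the unit-part retraction. [cite: SerreLocalFields1979, Ch. X §1 Prop. 3 (proof)] [cite: NeukirchANT1999, Ch. V §1 Thm. (1.3)] -/
theorem exists_isOfFinOrder_apply_mul_inv_eq (σ : w.adicCompletion K ≃+* w.adicCompletion K)
    (hσσ : ∀ x, σ (σ x) = x) (hσv : ∀ x, Valued.v (σ x) = Valued.v x)
    (Λ : (w.adicCompletion K)ˣ →* ℂˣ) (hΛ : Continuous Λ)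
    (hfix : ∀ x : (w.adicCompletion K)ˣ, σ x = x → Λ x = 1) :
    ∃ θ : (w.adicCompletion K)ˣ →* ℂˣ, IsOpen (θ.ker : Set (w.adicCompletion K)ˣ) ∧ IsOfFinOrder θ ∧
      ∀ x : (w.adicCompletion K)ˣ, θ (x * (Units.mapEquiv σ.toMulEquiv x)⁻¹) = Λ x := by
  classical
  -- the unit-level involution `σu` and the anti-symmetrisation `q x = x · (σ x)⁻¹`
  set σu : (w.adicCompletion K)ˣ ≃* (w.adicCompletion K)ˣ := Units.mapEquiv σ.toMulEquiv with hσu_def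
  have hσu : ∀ x : (w.adicCompletion K)ˣ, ((σu x : (w.adicCompletion K)ˣ) : w.adicCompletion K) = σ x := fun _ => rfl
  have hσuσu : ∀ x, σu (σu x) = x := fun x => Units.ext (by rw [hσu, hσu, hσσ])
  let q : (w.adicCompletion K)ˣ →* (w.adicCompletion K)ˣ :=
    { toFun := fun x => x * (σu x)⁻¹
      map_one' := by rw [map_one, inv_one, mul_one]
      map_mul' := fun x y => by rw [map_mul, mul_inv, mul_mul_mul_comm] }
  have hq : ∀ x, q x = x * (σu x)⁻¹ := fun _ => rfl
  -- (0) algebra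
  have hfix' : ∀ x, σu x = x → Λ x = 1 := fun x hx => hfix x (by rw [← hσu, hx])
  have hvq : ∀ x, Valued.v ((q x : (w.adicCompletion K)ˣ) : w.adicCompletion K) = 1 := fun x => by
    rw [hq, Units.val_mul, Units.val_inv_eq_inv_val, hσu, Valuation.map_mul, map_inv₀, hσv,
      mul_inv_cancel₀ ((Valuation.ne_zero_iff _).2 x.ne_zero)]
  have hσq : ∀ x, σu (q x) = (q x)⁻¹ := fun x => by
    rw [hq, map_mul, map_inv, hσuσu, mul_inv_rev, inv_inv]
  -- (1) `Λ` kills a congruence ball `H₁ = {v(x - 1) < γ₁}`, `γ₁ ≤ 1`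
  have hV := Literature.GroupTheory.PiCharacter.isNSSNhd_units_complex
  have h1 : Λ ⁻¹' {u : ℂˣ | ‖(u : ℂ) - 1‖ < 2⁻¹} ∈ 𝓝 (1 : (w.adicCompletion K)ˣ) :=
    hΛ.continuousAt.preimage_mem_nhds (by rw [map_one]; exact hV.1)
  rw [Units.isEmbedding_val₀.nhds_eq_comap, Filter.mem_comap] at h1
  obtain ⟨t, ht, hts⟩ := h1
  rw [Units.val_one, Valued.mem_nhds] at ht
  obtain ⟨γ, hγt⟩ := ht
  obtain ⟨γ₁, hγ₁γ, hγ₁1u⟩ : ∃ γ₁, γ₁ ≤ γ ∧ γ₁ ≤ 1 := ⟨min γ 1, min_le_left _ _, min_le_right _ _⟩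
  have hγ₁1 : γ₁.val ≤ 1 := by
    rw [← Units.val_one, Units.val_le_val]; exact hγ₁1u
  have hγ₁γ' : γ₁.val ≤ γ.val := Units.val_le_val.2 hγ₁γ
  obtain ⟨H₁, hH₁⟩ := exists_ballSubgroup w γ₁ hγ₁1
  have hΛH₁ : ∀ x ∈ H₁, Λ x = 1 := by
    have hsub : ((H₁.map Λ : Subgroup ℂˣ) : Set ℂˣ) ⊆ {u : ℂˣ | ‖(u : ℂ) - 1‖ < 2⁻¹} := by
      rintro _ ⟨x, hx, rfl⟩
      have hx' : (x : w.adicCompletion K) ∈ t := hγt (lt_of_lt_of_le ((hH₁ x).1 hx) hγ₁γ')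
      exact hts hx'
    have hbot := hV.2 _ hsub
    intro x hx
    exact Subgroup.mem_bot.1 (hbot ▸ Subgroup.mem_map_of_mem Λ hx)
  -- (2) the local section: if `v(q x - 1) < γ₁ · v(2)` then `Λ x = 1`
  have h2ne : (2 : w.adicCompletion K) ≠ 0 := by
    rw [← map_ofNat (algebraMap K (w.adicCompletion K)) 2]
    exact (map_ne_zero_iff _ (algebraMap K (w.adicCompletion K)).injective).2 two_ne_zero
  have hv2 : Valued.v.restrict (2 : w.adicCompletion K) ≠ 0 := (Valuation.ne_zero_iff _).2 h2ne
  have hv2le : Valued.v.restrict (2 : w.adicCompletion K) ≤ 1 := by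
    have h := Valuation.map_add Valued.v.restrict (1 : w.adicCompletion K) 1
    rw [Valuation.map_one, max_self, one_add_one_eq_two] at h
    exact h
  set γ₂ : (MonoidWithZeroHom.ValueGroup₀ (.ofClass (Valued.v : Valuation (w.adicCompletion K) (WithZero (Multiplicative ℤ)))))ˣ :=
    γ₁ * Units.mk0 _ hv2 with hγ₂def
  have hγ₂ : γ₂.val = γ₁.val * Valued.v.restrict (2 : w.adicCompletion K) := rfl
  have hγ₂le : γ₂.val ≤ γ₁.val := by
    rw [hγ₂]; exact mul_le_of_le_one_right' hv2le
  have hγ₂1 : γ₂.val ≤ 1 := hγ₂le.trans hγ₁1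
  have hsec : ∀ x : (w.adicCompletion K)ˣ, Valued.v.restrict (((q x : (w.adicCompletion K)ˣ) : w.adicCompletion K) - 1) < γ₂ → Λ x = 1 := by
    intro x hx
    -- `b := (1 + y)/2`, `y = q x`
    set y : w.adicCompletion K := ((q x : (w.adicCompletion K)ˣ) : w.adicCompletion K) with hydef
    set b : w.adicCompletion K := (1 + y) * 2⁻¹ with hbdef
    have hb1 : b - 1 = (y - 1) * 2⁻¹ := by
      rw [hbdef]; field_simp; ring
    have hvb1 : Valued.v.restrict (b - 1) < γ₁ := by
      rw [hb1, Valuation.map_mul, map_inv₀]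
      calc Valued.v.restrict (y - 1) * (Valued.v.restrict (2 : w.adicCompletion K))⁻¹
          < γ₂.val * (Valued.v.restrict (2 : w.adicCompletion K))⁻¹ := by
            exact mul_lt_mul_of_pos_right hx (zero_lt_iff.2 (inv_ne_zero hv2))
        _ = γ₁.val := by rw [hγ₂, mul_inv_cancel_right₀ hv2]
    have hvb : Valued.v.restrict b = 1 := by
      have h := Valuation.map_one_add_of_lt Valued.v.restrict (lt_of_lt_of_le hvb1 hγ₁1)
      rwa [add_sub_cancel] at h
    have hb0 : b ≠ 0 := by
      intro h; rw [h, Valuation.map_zero] at hvb; exact zero_ne_one hvb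
    set bu : (w.adicCompletion K)ˣ := Units.mk0 b hb0 with hbudef
    have hbuH : bu ∈ H₁ := (hH₁ bu).2 hvb1
    -- `x · bu⁻¹` is `σ`-fixed
    have hyσ : σ y = y⁻¹ := by
      have h := congrArg (fun z : (w.adicCompletion K)ˣ => (z : w.adicCompletion K)) (hσq x)
      simp only [hσu, Units.val_inv_eq_inv_val] at h
      exact h
    have hy0 : y ≠ 0 := (q x).ne_zero
    have h2σ : σ (x : w.adicCompletion K) ≠ 0 := by rw [← hσu]; exact (σu x).ne_zero
    have hxy : σ (x : w.adicCompletion K) * y = x := by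
      rw [hydef, hq, Units.val_mul, Units.val_inv_eq_inv_val, hσu, mul_comm, inv_mul_cancel_right₀ h2σ]
    have hxσ : (x : w.adicCompletion K) * y⁻¹ = σ x := by
      calc (x : w.adicCompletion K) * y⁻¹ = σ x * y * y⁻¹ := by rw [hxy]
        _ = σ x := mul_inv_cancel_right₀ hy0 _
    have hσb : σ b = (1 + y⁻¹) * 2⁻¹ := by
      rw [hbdef, map_mul, map_add, map_one, hyσ, map_inv₀, map_ofNat]
    have hσb0 : σ b ≠ 0 := (map_ne_zero_iff _ σ.injective).2 hb0
    have key : σ (x : w.adicCompletion K) * b = x * σ b := by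
      rw [hσb, hbdef, ← mul_assoc, ← mul_assoc, mul_add, mul_one, mul_add, mul_one, hxy, hxσ, add_comm]
    have hfixb : σu (x * bu⁻¹) = x * bu⁻¹ := by
      apply Units.ext
      rw [map_mul, map_inv, Units.val_mul, Units.val_inv_eq_inv_val, Units.val_mul, Units.val_inv_eq_inv_val, hσu, hσu]
      change σ (x : w.adicCompletion K) * (σ b)⁻¹ = x * b⁻¹
      rw [mul_inv_eq_iff_eq_mul₀ hσb0, mul_assoc, mul_comm b⁻¹, ← mul_assoc, ← key, mul_inv_cancel_right₀ hb0]
    calc Λ x = Λ (x * bu⁻¹ * bu) := by rw [inv_mul_cancel_right]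
      _ = 1 := by rw [map_mul, hfix' _ hfixb, one_mul, hΛH₁ bu hbuH]
  -- (3) the open subgroup `U = {v(x - 1) < γ₂}` inside the unit group: `q x ∈ U → Λ x = 1`
  obtain ⟨U, hU⟩ := exists_ballSubgroup w γ₂ hγ₂1
  have hqU : ∀ x, q x ∈ U → Λ x = 1 := fun x hx => hsec x ((hU _).1 hx)
  have hUH₁ : U ≤ H₁ := fun x hx => (hH₁ x).2 (lt_of_lt_of_le ((hU x).1 hx) hγ₂le)
  have hUnhds : (U : Set (w.adicCompletion K)ˣ) ∈ 𝓝 (1 : (w.adicCompletion K)ˣ) := by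
    rw [Units.isEmbedding_val₀.nhds_eq_comap, Filter.mem_comap]
    refine ⟨{y | Valued.v.restrict (y - 1) < γ₂.val}, ?_, fun x hx => (hU x).2 hx⟩
    rw [Units.val_one, Valued.mem_nhds]
    exact ⟨γ₂, subset_rfl⟩
  have hUopen : IsOpen (U : Set (w.adicCompletion K)ˣ) := U.isOpen_of_mem_nhds hUnhds
  have hv1U : ∀ x ∈ U, Valued.v (x : w.adicCompletion K) = 1 := fun x hx => by
    have h := Valuation.map_one_add_of_lt Valued.v.restrict (lt_of_lt_of_le ((hU x).1 hx) hγ₂1)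
    rw [add_sub_cancel, Valuation.restrict_eq_one_iff] at h
    exact h
  -- (4) the unit group `𝒪_wˣ` (compact open) and the finite quotient `𝒪_wˣ ⧸ U`
  set Kw : Subgroup (w.adicCompletion K)ˣ := (ValuativeRel.valuation (w.adicCompletion K)).valuationSubring.unitGroup with hKw
  have hmemKw : ∀ x : (w.adicCompletion K)ˣ, x ∈ Kw ↔ Valued.v (x : w.adicCompletion K) = 1 := fun x => by
    rw [hKw, Valuation.mem_unitGroup_iff, ← v_eq_one_iff_valuation_eq_one]
  haveI : CompactSpace Kw :=
    isCompact_iff_compactSpace.1 (Literature.NumberTheory.GaloisRepresentations.isCompact_unitGroup (w.adicCompletion K))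
  have hUK : U ≤ Kw := fun x hx => (hmemKw x).2 (hv1U x hx)
  set UK : Subgroup Kw := U.subgroupOf Kw with hUKdef
  have hUKopen : IsOpen (UK : Set Kw) := hUopen.preimage continuous_subtype_val
  haveI : Finite (Kw ⧸ UK) := Subgroup.quotient_finite_of_isOpen UK hUKopen
  -- (5) `q` lands in `𝒪_wˣ`; the character `Λ` descends to the image of `q` in `𝒪_wˣ ⧸ U`
  have hqK : ∀ x, q x ∈ Kw := fun x => (hmemKw _).2 (hvq x)
  let qK : (w.adicCompletion K)ˣ →* Kw := q.codRestrict Kw hqK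
  let g : (w.adicCompletion K)ˣ →* Kw ⧸ UK := (QuotientGroup.mk' UK).comp qK
  have hg : ∀ x, g x = QuotientGroup.mk' UK (qK x) := fun _ => rfl
  have hgker : g.ker ≤ Λ.ker := by
    intro x hx
    rw [MonoidHom.mem_ker] at hx ⊢
    rw [hg, QuotientGroup.mk'_apply, QuotientGroup.eq_one_iff] at hx
    exact hqU x (Subgroup.mem_subgroupOf.1 hx)
  let χH : g.range →* ℂˣ :=
    (QuotientGroup.lift g.ker Λ hgker).comp (QuotientGroup.quotientKerEquivRange g).symm.toMonoidHom
  have hχH : ∀ x, χH ⟨g x, ⟨x, rfl⟩⟩ = Λ x := by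
    intro x
    have hsymm : (QuotientGroup.quotientKerEquivRange g).symm ⟨g x, ⟨x, rfl⟩⟩ = (x : (w.adicCompletion K)ˣ ⧸ g.ker) := by
      apply (QuotientGroup.quotientKerEquivRange g).injective
      rw [MulEquiv.apply_symm_apply]
      rfl
    change QuotientGroup.lift g.ker Λ hgker ((QuotientGroup.quotientKerEquivRange g).symm ⟨g x, ⟨x, rfl⟩⟩) = Λ x
    rw [hsymm, QuotientGroup.lift_mk]
  -- (6) extension to the finite group `𝒪_wˣ ⧸ U` (duality for finite abelian groups)
  haveI hexp : NeZero (Monoid.exponent (Kw ⧸ UK)) := ⟨Monoid.exponent_ne_zero_of_finite (G := Kw ⧸ UK)⟩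
  haveI : NeZero ((Monoid.exponent (Kw ⧸ UK) : ℕ) : ℂ) := NeZero.charZero
  obtain ⟨θbar, hθbar⟩ := (MonoidHom.restrict_surjective ℂ (G := Kw ⧸ UK) g.range) χH
  have hθbar' : ∀ x, θbar (g x) = Λ x := fun x => by
    have h := DFunLike.congr_fun hθbar ⟨g x, ⟨x, rfl⟩⟩
    rw [MonoidHom.restrictHom_apply, MonoidHom.restrict_apply] at h
    rw [← hχH x]
    exact h
  -- (7) the unit-part retraction and `θ := θbar ∘ (𝒪_wˣ → 𝒪_wˣ ⧸ U) ∘ υ`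
  obtain ⟨υ, hυ1, hυid⟩ := exists_unitRetraction w
  have hυK : ∀ x, υ x ∈ Kw := fun x => (hmemKw _).2 (hυ1 x)
  let υK : (w.adicCompletion K)ˣ →* Kw := υ.codRestrict Kw hυK
  let θ : (w.adicCompletion K)ˣ →* ℂˣ := θbar.comp ((QuotientGroup.mk' UK).comp υK)
  have hθ : ∀ x, θ x = θbar (QuotientGroup.mk' UK (υK x)) := fun _ => rfl
  refine ⟨θ, ?_, ?_, fun x => ?_⟩
  · -- open kernel: it contains `U`
    refine Subgroup.isOpen_of_mem_nhds _ (Filter.mem_of_superset hUnhds fun u hu => ?_)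
    rw [SetLike.mem_coe, MonoidHom.mem_ker, hθ]
    have hυu : υK u = ⟨u, hUK hu⟩ := Subtype.ext (hυid u (hv1U u hu))
    have hmem : (⟨u, hUK hu⟩ : Kw) ∈ UK := Subgroup.mem_subgroupOf.2 hu
    rw [hυu, QuotientGroup.mk'_apply, (QuotientGroup.eq_one_iff _).2 hmem, map_one]
  · -- finite order: `θ ^ |𝒪_wˣ ⧸ U| = 1`
    refine isOfFinOrder_iff_pow_eq_one.2 ⟨Nat.card (Kw ⧸ UK), Nat.card_pos, MonoidHom.ext fun x => ?_⟩
    rw [MonoidHom.pow_apply, MonoidHom.one_apply, hθ, ← map_pow, pow_card_eq_one', map_one]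
  · -- `θ (x · (σ x)⁻¹) = Λ x`
    change θ (q x) = Λ x
    rw [hθ]
    have hυq : υK (q x) = qK x := Subtype.ext (hυid _ (hvq x))
    rw [hυq, ← hg]
    exact hθbar' x

end Local

end Literature.NumberTheory.Automorphic.LocalAntiInvariantCharacter

end
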